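import Literature.NumberTheory.LFunctions.Zhang2022.Section7MeanSquareMajorant
import Literature.NumberTheory.Sieve.DivisorBound
import Literature.NumberTheory.Sieve.QuadraticRootsPrimeModuliDFISieveEstimates
import Literature.NumberTheory.Sieve.SmoothParityHcSumLemmas
import HarnessLib

/-!
# Zhang (2022) §7–§8: elementary majorants for the coefficients `ξ₀ⱼ(n;d,r)` — auxiliary file

Cell `siegel-zhang` (D-0069 width campaign), layer L2; auxiliary to `Section7XiZeroSummable`,
which proves the absolute convergence of `Σ_n χ(n)ξ₀ⱼ(n;d,r)n^{−s}` on `Re s = 2` presupposed by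
display (8.9) of Y. Zhang, arXiv:2211.02515v1 [Zhang2022LandauSiegel] (an unrefereed manuscript
under adjudication; nothing here concerns its Theorems 1–2). This file is pure elementary
multiplicative number theory with crude explicit constants:

* `one_add_div_le_rpow`: `1 + a/q ≤ q^θ` for `q ≥ P₀ ≥ 8`, `a ≤ 2θP₀`;
* `prod_primeFactors_le_pow_mul_rpow`: if `0 ≤ u(q) ≤ U` at every prime and `u(q) ≤ q^θ` for
  `q ≥ P₀`, then `∏_{q∣n} u(q) ≤ U^{P₀} n^θ` ("small primes by a constant, large primes by `q^θ`");
* `norm_kappa_le_card_divisors_pow`: Zhang's `κ` (p.32, `Σκ(n)n^{−s} = ζ(s+β₁)ζ(s+β₂)ζ(s+β₃)/ζ(s)`,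
  the tree's `MeanSquareMajorant.kappa`) satisfies `|κ(m)| ≤ τ(m)³` (from the tree's
  `|κ(p^k)| ≤ (k+1)³` and multiplicativity);
* `tsum_cube_div_pow_le`: the local factor `Σ_e (e+1)³p^{−e} ≤ 1 + 192/(2p − 3)` (`p ≥ 2`);
* `tsum_factoredNumbers_cubeDiv_le`: `Σ_{h ∈ 𝔫(d)} τ(h)³/h ≤ 193^{768} d^{1/8}`, the sum over the
  integers all of whose prime factors divide `d` (Mathlib's `Nat.factoredNumbers d.primeFactors`;
  Euler product via `EulerProduct.summable_and_hasSum_factoredNumbers_prod_filter_prime_tsum`).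

[cite: Zhang2022LandauSiegel, §7 p.32 (the objects `𝔫(d)`, `κ`, `κ̃`, `ξ₀ⱼ`)]
-/

noncomputable section

open Real Finset

namespace Literature.NumberTheory.LFunctions.Zhang2022.XiZeroMajorants

/-! ### Small primes by a constant, large primes by `q^θ` -/

/-- `log 8 > 2` (`e² < 7.39 < 8`). [folklore] -/
private theorem two_lt_log_eight : (2 : ℝ) < Real.log 8 := by
  rw [Real.lt_log_iff_exp_lt (by norm_num)]
  have h := Real.exp_one_lt_d9
  have h2 : Real.exp 2 = Real.exp 1 * Real.exp 1 := by rw [← Real.exp_add]; norm_num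
  rw [h2]
  nlinarith [Real.exp_pos 1]

/-- `1 + a/q ≤ q^θ` whenever `q ≥ P₀ ≥ 8`, `θ ≥ 0` and `a ≤ 2θP₀` (since
`1 + a/q ≤ e^{a/q}` and `a/q ≤ 2θ ≤ θ log q`). [cite: Zhang2022LandauSiegel, §7 p.32] -/
theorem one_add_div_le_rpow {a θ : ℝ} {P₀ q : ℕ} (hθ : 0 ≤ θ) (h8 : 8 ≤ P₀)
    (hq : P₀ ≤ q) (haθ : a ≤ 2 * θ * P₀) : 1 + a / q ≤ (q : ℝ) ^ θ := by
  have hP0 : (0 : ℝ) < P₀ := by exact_mod_cast (show 0 < P₀ by omega)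
  have hq0 : (0 : ℝ) < q := by exact_mod_cast (show 0 < q by omega)
  have hq8 : (8 : ℝ) ≤ q := by exact_mod_cast (le_trans h8 hq)
  have hlog : 2 ≤ Real.log q :=
    (two_lt_log_eight.trans_le (Real.log_le_log (by norm_num) hq8)).le
  have h1 : a / q ≤ 2 * θ := by
    rw [div_le_iff₀ hq0]
    have : (P₀ : ℝ) ≤ q := by exact_mod_cast hq
    nlinarith
  have h2 : a / q ≤ θ * Real.log q := by nlinarith
  calc 1 + a / q ≤ Real.exp (a / q) := by
        have := Real.add_one_le_exp (a / q); linarith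
    _ ≤ Real.exp (θ * Real.log q) := Real.exp_le_exp.mpr h2
    _ = (q : ℝ) ^ θ := by rw [Real.rpow_def_of_pos hq0, mul_comm]

/-- **Small primes by a constant, large primes by `q^θ`.** If `0 ≤ u(q) ≤ U` (`U ≥ 1`) for every
prime `q` and `u(q) ≤ q^θ` (`θ ≥ 0`) for every prime `q ≥ P₀`, then for `n ≥ 1`,
`∏_{q ∣ n} u(q) ≤ U^{P₀} n^θ` (at most `P₀` primes below `P₀`; `∏_{q∣n} q ≤ n`).
[cite: Zhang2022LandauSiegel, §7 p.32] -/
theorem prod_primeFactors_le_pow_mul_rpow (u : ℕ → ℝ) {U θ : ℝ} (P₀ : ℕ) (hU : 1 ≤ U)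
    (hθ : 0 ≤ θ) (h0 : ∀ q, q.Prime → 0 ≤ u q) (h1 : ∀ q, q.Prime → u q ≤ U)
    (h2 : ∀ q, q.Prime → P₀ ≤ q → u q ≤ (q : ℝ) ^ θ) {n : ℕ} (hn : n ≠ 0) :
    ∏ q ∈ n.primeFactors, u q ≤ U ^ P₀ * (n : ℝ) ^ θ := by
  rw [← Finset.prod_filter_mul_prod_filter_not n.primeFactors (fun q => q < P₀)]
  have hprime : ∀ q ∈ n.primeFactors, q.Prime := fun q hq => Nat.prime_of_mem_primeFactors hq
  -- small primes
  have hsmall : ∏ q ∈ n.primeFactors.filter (fun q => q < P₀), u q ≤ U ^ P₀ := by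
    calc ∏ q ∈ n.primeFactors.filter (fun q => q < P₀), u q
        ≤ ∏ q ∈ n.primeFactors.filter (fun q => q < P₀), U := by
          apply Finset.prod_le_prod
          · intro q hq; exact h0 q (hprime q (Finset.mem_filter.1 hq).1)
          · intro q hq; exact h1 q (hprime q (Finset.mem_filter.1 hq).1)
      _ = U ^ (n.primeFactors.filter (fun q => q < P₀)).card := Finset.prod_const U
      _ ≤ U ^ P₀ := by
          apply pow_le_pow_right₀ hU
          calc (n.primeFactors.filter (fun q => q < P₀)).card ≤ (Finset.range P₀).card :=
                Finset.card_le_card fun q hq => Finset.mem_range.2 (Finset.mem_filter.1 hq).2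
            _ = P₀ := Finset.card_range P₀
  -- large primes
  have hlarge : ∏ q ∈ n.primeFactors.filter (fun q => ¬ q < P₀), u q ≤ (n : ℝ) ^ θ := by
    calc ∏ q ∈ n.primeFactors.filter (fun q => ¬ q < P₀), u q
        ≤ ∏ q ∈ n.primeFactors.filter (fun q => ¬ q < P₀), (q : ℝ) ^ θ := by
          apply Finset.prod_le_prod
          · intro q hq; exact h0 q (hprime q (Finset.mem_filter.1 hq).1)
          · intro q hq
            have hq' := Finset.mem_filter.1 hq
            exact h2 q (hprime q hq'.1) (not_lt.1 hq'.2)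
      _ ≤ ∏ q ∈ n.primeFactors, (q : ℝ) ^ θ := by
          rw [← Finset.prod_filter_mul_prod_filter_not n.primeFactors (fun q => q < P₀)
            (f := fun q => (q : ℝ) ^ θ)]
          refine le_mul_of_one_le_left (Finset.prod_nonneg fun q _ => by positivity) ?_
          calc (1 : ℝ) = ∏ q ∈ n.primeFactors.filter (fun q => q < P₀), (1 : ℝ) :=
                Finset.prod_const_one.symm
            _ ≤ ∏ q ∈ n.primeFactors.filter (fun q => q < P₀), (q : ℝ) ^ θ := by
                apply Finset.prod_le_prod (fun _ _ => zero_le_one)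
                intro q hq
                exact Real.one_le_rpow
                  (by exact_mod_cast (hprime q (Finset.mem_filter.1 hq).1).one_lt.le) hθ
      _ = ((∏ q ∈ n.primeFactors, q : ℕ) : ℝ) ^ θ := by
          rw [Nat.cast_prod, Real.finsetProd_rpow]
          intro q hq; exact_mod_cast (hprime q hq).pos.le
      _ ≤ (n : ℝ) ^ θ := by
          apply Real.rpow_le_rpow (by positivity) _ hθ
          exact_mod_cast Nat.le_of_dvd (Nat.pos_of_ne_zero hn) (Nat.prod_primeFactors_dvd n)
  have hl0 : 0 ≤ ∏ q ∈ n.primeFactors.filter (fun q => ¬ q < P₀), u q :=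
    Finset.prod_nonneg fun q hq => h0 q (hprime q (Finset.mem_filter.1 hq).1)
  calc _ ≤ U ^ P₀ * ∏ q ∈ n.primeFactors.filter (fun q => ¬ q < P₀), u q :=
        mul_le_mul_of_nonneg_right hsmall hl0
    _ ≤ U ^ P₀ * (n : ℝ) ^ θ := mul_le_mul_of_nonneg_left hlarge (by positivity)

/-! ### Divisor-function algebra -/

/-! `τ(ab) ≤ τ(a)τ(b)` and `τ(p^e) = e + 1` are the tree's
`Literature.NumberTheory.Sieve.DFI1995.card_divisors_mul_le` and
`Literature.NumberTheory.Sieve.SmoothArcs.divisors_card_prime_pow` (reused, not restated). -/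

/-! ### `|κ(m)| ≤ τ(m)³` -/

/-- **`|κ(m)| ≤ τ(m)³`** for Zhang's `κ` (p.32; the tree's `MeanSquareMajorant.kappa b₁ b₂ b₃`, any
real `b`'s): multiplicative with `|κ(p^k)| ≤ (k+1)³ = τ(p^k)³` (`norm_kappa_prime_pow_le`).
[cite: Zhang2022LandauSiegel, §7 p.32] -/
theorem norm_kappa_le_card_divisors_pow (b₁ b₂ b₃ : ℝ) :
    ∀ m : ℕ, m ≠ 0 → ‖MeanSquareMajorant.kappa b₁ b₂ b₃ m‖ ≤ (m.divisors.card : ℝ) ^ 3 := by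
  have hκ := MeanSquareMajorant.isMultiplicative_kappa b₁ b₂ b₃
  intro m
  induction m using Nat.recOnPosPrimePosCoprime with
  | prime_pow p k hp hk =>
    intro _
    rw [Literature.NumberTheory.Sieve.SmoothArcs.divisors_card_prime_pow hp]
    have := MeanSquareMajorant.norm_kappa_prime_pow_le b₁ b₂ b₃ hp k
    exact_mod_cast this
  | zero => intro h; exact absurd rfl h
  | one =>
    intro _
    rw [hκ.map_one]
    simp
  | coprime a b ha hb hab iha ihb =>
    intro _
    rw [hκ.map_mul_of_coprime hab, norm_mul, Nat.Coprime.card_divisors_mul hab, Nat.cast_mul,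
      mul_pow]
    exact mul_le_mul (iha (by omega)) (ihb (by omega)) (norm_nonneg _) (by positivity)

/-! ### The local Euler factor `Σ_e (e+1)³ p^{−e}` -/

/-- `(e+1)³ ≤ 64·(3/2)^e` for every `e` (checked for `e ≤ 6`; for `e ≥ 6` the ratio
`((e+2)/(e+1))³ ≤ (8/7)³ < 3/2`). [folklore] -/
private theorem succ_pow_three_le (e : ℕ) : ((e : ℝ) + 1) ^ 3 ≤ 64 * (3 / 2 : ℝ) ^ e := by
  induction e with
  | zero => norm_num
  | succ k ih =>
    by_cases hk : k < 6
    · interval_cases k <;> norm_num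
    · rw [not_lt] at hk
      have hk' : (6 : ℝ) ≤ k := by exact_mod_cast hk
      have step : ((k : ℝ) + 1 + 1) ^ 3 ≤ 3 / 2 * ((k : ℝ) + 1) ^ 3 := by
        nlinarith [mul_nonneg (sub_nonneg.2 hk') (by positivity : (0 : ℝ) ≤ (k : ℝ) ^ 2 + 3 * k + 3)]
      calc ((↑(k + 1) : ℝ) + 1) ^ 3 = ((k : ℝ) + 1 + 1) ^ 3 := by push_cast; ring
        _ ≤ 3 / 2 * ((k : ℝ) + 1) ^ 3 := step
        _ ≤ 3 / 2 * (64 * (3 / 2 : ℝ) ^ k) := by gcongr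
        _ = 64 * (3 / 2 : ℝ) ^ (k + 1) := by ring

/-- The local factor at a prime (indeed any integer) `p ≥ 2`: `Σ_{e≥0} (e+1)³/p^e` converges and is
`≤ 1 + 192/(2p − 3)` (compare with `64Σ_{e≥1}(3/(2p))^e`). [cite: Zhang2022LandauSiegel, §7 p.32] -/
theorem summable_cube_div_pow {p : ℕ} (hp : 2 ≤ p) :
    Summable fun e : ℕ => ((e : ℝ) + 1) ^ 3 / (p : ℝ) ^ e := by
  have hp0 : (0 : ℝ) < p := by exact_mod_cast (show 0 < p by omega)
  have hp2 : (2 : ℝ) ≤ p := by exact_mod_cast hp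
  have hr : (3 / 2 : ℝ) / p < 1 := by
    rw [div_lt_one hp0]; linarith
  have hr0 : 0 ≤ (3 / 2 : ℝ) / p := by positivity
  refine Summable.of_nonneg_of_le (fun e => by positivity) (fun e => ?_)
    ((summable_geometric_of_lt_one hr0 hr).mul_left 64)
  rw [div_pow, div_le_iff₀ (by positivity)]
  calc ((e : ℝ) + 1) ^ 3 ≤ 64 * (3 / 2 : ℝ) ^ e := succ_pow_three_le e
    _ = 64 * ((3 / 2 : ℝ) ^ e / (p : ℝ) ^ e) * (p : ℝ) ^ e := by
        field_simp

/-- `Σ_{e≥0} (e+1)³/p^e ≤ 1 + 192/(2p − 3)` for `p ≥ 2`. [cite: Zhang2022LandauSiegel, §7 p.32] -/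
theorem tsum_cube_div_pow_le {p : ℕ} (hp : 2 ≤ p) :
    ∑' e : ℕ, ((e : ℝ) + 1) ^ 3 / (p : ℝ) ^ e ≤ 1 + 192 / (2 * (p : ℝ) - 3) := by
  have hp0 : (0 : ℝ) < p := by exact_mod_cast (show 0 < p by omega)
  have hp2 : (2 : ℝ) ≤ p := by exact_mod_cast hp
  set r : ℝ := (3 / 2 : ℝ) / p with hr_def
  have hr : r < 1 := by rw [hr_def, div_lt_one hp0]; linarith
  have hr0 : 0 ≤ r := by positivity
  have hs := summable_cube_div_pow hp
  rw [hs.tsum_eq_zero_add]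
  simp only [Nat.cast_zero, zero_add, one_pow, pow_zero, div_one]
  have hgeom : Summable fun e : ℕ => 64 * r ^ (e + 1) :=
    ((summable_geometric_of_lt_one hr0 hr).mul_left 64).comp_injective (add_left_injective 1) |>.congr
      (fun e => by simp [Function.comp])
  have hle : ∀ e : ℕ, ((((e + 1 : ℕ) : ℝ)) + 1) ^ 3 / (p : ℝ) ^ (e + 1) ≤ 64 * r ^ (e + 1) := by
    intro e
    rw [hr_def, div_pow, div_le_iff₀ (by positivity)]
    calc (((e + 1 : ℕ) : ℝ) + 1) ^ 3 = (((e + 1 : ℕ) : ℝ) + 1) ^ 3 := rfl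
      _ ≤ 64 * (3 / 2 : ℝ) ^ (e + 1) := by exact_mod_cast succ_pow_three_le (e + 1)
      _ = 64 * ((3 / 2 : ℝ) ^ (e + 1) / (p : ℝ) ^ (e + 1)) * (p : ℝ) ^ (e + 1) := by field_simp
  have hsum_le : ∑' e : ℕ, (((e + 1 : ℕ) : ℝ) + 1) ^ 3 / (p : ℝ) ^ (e + 1) ≤
      ∑' e : ℕ, 64 * r ^ (e + 1) :=
    Summable.tsum_le_tsum hle ((summable_nat_add_iff 1).mpr hs |>.congr (fun e => by simp)) hgeom
  have hval : ∑' e : ℕ, 64 * r ^ (e + 1) = 64 * (r / (1 - r)) := by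
    rw [tsum_mul_left]
    congr 1
    rw [show (fun e : ℕ => r ^ (e + 1)) = fun e => r * r ^ e from funext fun e => by ring,
      tsum_mul_left, tsum_geometric_of_lt_one hr0 hr, div_eq_mul_inv]
  have hfin : 64 * (r / (1 - r)) = 192 / (2 * (p : ℝ) - 3) := by
    rw [hr_def]
    have h1 : (2 : ℝ) * p - 3 ≠ 0 := by linarith
    field_simp
    ring
  calc 1 + ∑' e : ℕ, (((e + 1 : ℕ) : ℝ) + 1) ^ 3 / (p : ℝ) ^ (e + 1)
      ≤ 1 + ∑' e : ℕ, 64 * r ^ (e + 1) := by linarith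
    _ = 1 + 192 / (2 * (p : ℝ) - 3) := by rw [hval, hfin]

/-! ### The sum over `𝔫(d)` -/

/-- The summand `τ(h)³/h` (as a real function of `h`) equals `1` at `h = 1`. [folklore] -/
private theorem cubeDiv_one : (((1 : ℕ).divisors.card : ℝ)) ^ 3 / ((1 : ℕ) : ℝ) = 1 := by simp

/-- `τ(h)³/h` is multiplicative on coprime arguments. [folklore] -/
private theorem cubeDiv_mul_of_coprime {m n : ℕ} (h : Nat.Coprime m n) :
    (((m * n).divisors.card : ℝ)) ^ 3 / ((m * n : ℕ) : ℝ) =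
      ((m.divisors.card : ℝ) ^ 3 / (m : ℝ)) * ((n.divisors.card : ℝ) ^ 3 / (n : ℝ)) := by
  rw [Nat.Coprime.card_divisors_mul h, Nat.cast_mul, Nat.cast_mul, mul_pow]
  rcases Nat.eq_zero_or_pos m with rfl | hm
  · simp
  rcases Nat.eq_zero_or_pos n with rfl | hn
  · simp
  have hm' : (m : ℝ) ≠ 0 := by exact_mod_cast hm.ne'
  have hn' : (n : ℝ) ≠ 0 := by exact_mod_cast hn.ne'
  field_simp

/-- `τ(p^e)³/p^e = (e+1)³/p^e`. [folklore] -/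
private theorem cubeDiv_prime_pow {p : ℕ} (hp : p.Prime) (e : ℕ) :
    (((p ^ e).divisors.card : ℝ)) ^ 3 / ((p ^ e : ℕ) : ℝ) = ((e : ℝ) + 1) ^ 3 / (p : ℝ) ^ e := by
  rw [Literature.NumberTheory.Sieve.SmoothArcs.divisors_card_prime_pow hp, Nat.cast_pow]
  push_cast
  ring

/-- `0 ≤ τ(h)³/h`. [folklore] -/
private theorem cubeDiv_nonneg (h : ℕ) : 0 ≤ ((h.divisors.card : ℝ)) ^ 3 / (h : ℝ) := by positivity

/-- **The sum over `𝔫(d)`** (the positive integers all of whose prime factors divide `d`, p.32;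
Mathlib's `Nat.factoredNumbers d.primeFactors`): `Σ_{h∈𝔫(d)} τ(h)³/h` converges, equals the
Euler product `∏_{p∣d} Σ_e (e+1)³p^{−e}`, and is `≤ 193^{768} · d^{1/8}` (`d ≥ 1`; each factor is
`≤ 1 + 192/(2p−3) ≤ 193`, and `≤ 1 + 192/p ≤ p^{1/8}` once `p ≥ 768`).
[cite: Zhang2022LandauSiegel, §7 p.32] -/
theorem tsum_factoredNumbers_cubeDiv_le {d : ℕ} (hd : d ≠ 0) :
    Summable (fun m : Nat.factoredNumbers d.primeFactors =>
        (((m : ℕ).divisors.card : ℝ)) ^ 3 / ((m : ℕ) : ℝ)) ∧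
      ∑' m : Nat.factoredNumbers d.primeFactors, (((m : ℕ).divisors.card : ℝ)) ^ 3 / ((m : ℕ) : ℝ) ≤
        (193 : ℝ) ^ (768 : ℕ) * (d : ℝ) ^ (1 / 8 : ℝ) := by
  set f : ℕ → ℝ := fun h => ((h.divisors.card : ℝ)) ^ 3 / (h : ℝ) with hf
  have hloc : ∀ {p : ℕ}, p.Prime → Summable (fun n : ℕ => ‖f (p ^ n)‖) := by
    intro p hp
    have : ∀ n : ℕ, ‖f (p ^ n)‖ = ((n : ℝ) + 1) ^ 3 / (p : ℝ) ^ n := fun n => by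
      rw [hf, Real.norm_eq_abs, abs_of_nonneg (cubeDiv_nonneg _), cubeDiv_prime_pow hp]
    simp_rw [this]
    exact summable_cube_div_pow hp.two_le
  have key := EulerProduct.summable_and_hasSum_factoredNumbers_prod_filter_prime_tsum
    (f := f) cubeDiv_one (fun hmn => cubeDiv_mul_of_coprime hmn) hloc d.primeFactors
  have hsum : Summable (fun m : Nat.factoredNumbers d.primeFactors => f m) :=
    Summable.of_norm key.1
  refine ⟨hsum, ?_⟩
  change ∑' m : Nat.factoredNumbers d.primeFactors, f m ≤ _
  rw [key.2.tsum_eq]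
  have hfilter : d.primeFactors.filter (fun p => p.Prime) = d.primeFactors :=
    Finset.filter_true_of_mem fun p hp => Nat.prime_of_mem_primeFactors hp
  rw [hfilter]
  have hfac : ∀ p ∈ d.primeFactors, ∑' n : ℕ, f (p ^ n) = ∑' n : ℕ, ((n : ℝ) + 1) ^ 3 / (p : ℝ) ^ n :=
    fun p hp => tsum_congr fun n => cubeDiv_prime_pow (Nat.prime_of_mem_primeFactors hp) n
  rw [Finset.prod_congr rfl hfac]
  refine prod_primeFactors_le_pow_mul_rpow (fun p => ∑' n : ℕ, ((n : ℝ) + 1) ^ 3 / (p : ℝ) ^ n)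
    768 (by norm_num) (by norm_num) (fun q hq => ?_) (fun q hq => ?_) (fun q hq hq' => ?_) hd
  · exact tsum_nonneg fun n => by positivity
  · have h2 : (2 : ℝ) ≤ q := by exact_mod_cast hq.two_le
    have hdiv : (192 : ℝ) / (2 * (q : ℝ) - 3) ≤ 192 / 1 :=
      div_le_div_of_nonneg_left (by norm_num) (by norm_num) (by linarith)
    calc _ ≤ 1 + 192 / (2 * (q : ℝ) - 3) := tsum_cube_div_pow_le hq.two_le
      _ ≤ 1 + 192 / 1 := by linarith
      _ = 193 := by norm_num
  · have h2 : (2 : ℝ) ≤ q := by exact_mod_cast hq.two_le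
    have h768 : (768 : ℝ) ≤ q := by exact_mod_cast hq'
    have hq0 : (0 : ℝ) < q := by linarith
    have hdiv : (192 : ℝ) / (2 * (q : ℝ) - 3) ≤ 192 / q :=
      div_le_div_of_nonneg_left (by norm_num) hq0 (by linarith)
    calc _ ≤ 1 + 192 / (2 * (q : ℝ) - 3) := tsum_cube_div_pow_le hq.two_le
      _ ≤ 1 + 192 / q := by linarith
      _ ≤ (q : ℝ) ^ (1 / 8 : ℝ) :=
          one_add_div_le_rpow (by norm_num) (by norm_num) hq' (by norm_num)

end Literature.NumberTheory.LFunctions.Zhang2022.XiZeroMajorants
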